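import Summits.ResolutionOfSingularities.ResolutionOfSingularities.Theorems.FrobeniusLadderFRationalResolutionVeroneseEtaleCharts
import Summits.ResolutionOfSingularities.ResolutionOfSingularities.Theorems.FrobeniusLadderFRationalResolutionSegreRegularOffVertex
import HarnessLib

/-!
# Crux `FrobeniusLadder.FRationalResolution` (stmt-ResolutionOfSingularities-15317), line `redirect`,
# stub `stub_diagonalizableQuotientResolution` — ÉTALE SEGRE-CONE singularities (e.g. threefold nodes) are resolvable

Companion of `…VeroneseEtaleCharts.lean` for the SEGRE cones `C(a,b) = Spec k[xᵢyⱼ]` (the affine cone over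
`ℙ^{a-1} × ℙ^{b-1}`; `a = b = 2`: the ordinary double point `xw = yz` of a threefold), quotients of `𝔸^{a+b}` by the
torus `𝔾_m` with weights `(+1,…,+1,−1,…,−1)`: leafhand-1's cone programme resolves the vertex by ONE blow-up
(`segreCone_isRegular_affineBlowup`); the point-blow-up transfer chain (`…EtaleChartAffineOpen`, no residue-field
condition) then resolves every variety with isolated singularities étale-locally of this form.

* `segre_exists_sub_algebraMap_mem_vertexIdeal`, `segre_vertexIdeal_ne_top`, `segre_vertexIdeal_isMaximal` — the
  vertex ideal `SM = (xᵢyⱼ)` of `k[xᵢyⱼ]` is maximal (`a, b ≥ 1`);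
* **`hasResolution_of_isolated_segre_etale_charts`** — an integral `X` locally of finite type over ANY field with
  finitely many singular points, each `= φ(vertex)` for an ÉTALE morphism `φ : Spec k[xᵢyⱼ] ⟶ X` (`a, b ≥ 2`), HAS A
  RESOLUTION OF SINGULARITIES (in particular: isolated singularities étale-equivalent to threefold nodes, every
  characteristic, arbitrary residue fields).

Honest label: special case toward the endgame stub (torus, not finite, group; no stub closed by name). No definitions,
no named facts, no sorry. [folklore; cite: Kollar2007, §2.2]
-/

noncomputable section

-- single-problem summit: the doubled namespace component is forced
set_option linter.dupNamespace false

open CategoryTheory AlgebraicGeometry TopologicalSpace MvPolynomial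
open Literature.AlgebraicGeometry.Resolution

namespace Summit.ResolutionOfSingularities.ResolutionOfSingularities.Theorems.FRationalResolution

section Segre

variable (k : Type) [Field k]

/-- The polynomial ring `k[x₁..x_a, y₁..y_b]`. -/
local notation3 "SP[" a ", " b "]" => MvPolynomial (Fin a ⊕ Fin b) k

/-- The Segre ring `k[xᵢyⱼ]`. -/
local notation3 "SR[" a ", " b "]" =>
  Algebra.adjoin k (Set.range (fun ij : Fin a × Fin b =>
    (MvPolynomial.X (R := k) (σ := Fin a ⊕ Fin b) (Sum.inl ij.1) *
      MvPolynomial.X (R := k) (σ := Fin a ⊕ Fin b) (Sum.inr ij.2) : MvPolynomial (Fin a ⊕ Fin b) k)))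

/-- The vertex ideal `(xᵢyⱼ)` of the Segre ring. -/
local notation3 "SM[" a ", " b "]" =>
  Ideal.span {v : ↥SR[a, b] | ∃ ij : Fin a × Fin b,
    (v : MvPolynomial (Fin a ⊕ Fin b) k) = MvPolynomial.X (Sum.inl ij.1) * MvPolynomial.X (Sum.inr ij.2)}

namespace SegreEtaleCharts

/-- Every element of the Segre ring is a scalar modulo the vertex ideal. [folklore] -/
theorem segre_exists_sub_algebraMap_mem_vertexIdeal (a b : ℕ) (v : ↥SR[a, b]) :
    ∃ c : k, v - algebraMap k ↥SR[a, b] c ∈ SM[a, b] := by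
  obtain ⟨x, hx⟩ := v
  induction hx using Algebra.adjoin_induction with
  | mem x hx =>
    obtain ⟨ij, rfl⟩ := hx
    refine ⟨0, ?_⟩
    rw [map_zero, sub_zero]
    exact Ideal.subset_span ⟨ij, rfl⟩
  | algebraMap c =>
    refine ⟨c, ?_⟩
    have : (⟨algebraMap k SP[a, b] c, Subalgebra.algebraMap_mem _ c⟩ : ↥SR[a, b]) =
        algebraMap k ↥SR[a, b] c := Subtype.ext rfl
    rw [this, sub_self]
    exact Ideal.zero_mem _
  | add x y hx hy ihx ihy =>
    obtain ⟨c₁, h₁⟩ := ihx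
    obtain ⟨c₂, h₂⟩ := ihy
    refine ⟨c₁ + c₂, ?_⟩
    have : (⟨x + y, add_mem hx hy⟩ : ↥SR[a, b]) - algebraMap k ↥SR[a, b] (c₁ + c₂) =
        ((⟨x, hx⟩ : ↥SR[a, b]) - algebraMap k ↥SR[a, b] c₁) + (⟨y, hy⟩ - algebraMap k ↥SR[a, b] c₂) := by
      rw [map_add]
      apply Subtype.ext
      simp only [Subalgebra.coe_sub, Subalgebra.coe_add]
      ring
    rw [this]
    exact Ideal.add_mem _ h₁ h₂
  | mul x y hx hy ihx ihy =>
    obtain ⟨c₁, h₁⟩ := ihx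
    obtain ⟨c₂, h₂⟩ := ihy
    refine ⟨c₁ * c₂, ?_⟩
    have : (⟨x * y, mul_mem hx hy⟩ : ↥SR[a, b]) - algebraMap k ↥SR[a, b] (c₁ * c₂) =
        (⟨x, hx⟩ : ↥SR[a, b]) * (⟨y, hy⟩ - algebraMap k ↥SR[a, b] c₂) +
          ((⟨x, hx⟩ : ↥SR[a, b]) - algebraMap k ↥SR[a, b] c₁) * algebraMap k ↥SR[a, b] c₂ := by
      rw [map_mul]
      apply Subtype.ext
      simp only [Subalgebra.coe_sub, Subalgebra.coe_add, Subalgebra.coe_mul]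
      ring
    rw [this]
    exact Ideal.add_mem _ (Ideal.mul_mem_left _ _ h₂) (Ideal.mul_mem_right _ _ h₁)

/-- The vertex ideal of the Segre ring is proper (its elements have vanishing constant coefficient). [folklore] -/
theorem segre_vertexIdeal_ne_top (a b : ℕ) : SM[a, b] ≠ ⊤ := by
  let cc : ↥SR[a, b] →+* k := (MvPolynomial.constantCoeff : SP[a, b] →+* k).comp (SR[a, b]).val.toRingHom
  have hle : SM[a, b] ≤ RingHom.ker cc := by
    rw [Ideal.span_le]
    rintro v ⟨ij, hv⟩
    rw [SetLike.mem_coe, RingHom.mem_ker]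
    change MvPolynomial.constantCoeff (v : SP[a, b]) = 0
    rw [hv, map_mul, MvPolynomial.constantCoeff_X, zero_mul]
  intro htop
  have h1 : (1 : ↥SR[a, b]) ∈ RingHom.ker cc := hle (htop ▸ Submodule.mem_top)
  rw [RingHom.mem_ker, map_one] at h1
  exact one_ne_zero h1

/-- **The vertex ideal of the Segre ring is maximal.** [folklore] -/
theorem segre_vertexIdeal_isMaximal (a b : ℕ) : (SM[a, b]).IsMaximal := by
  rw [Ideal.isMaximal_iff]
  refine ⟨fun h1 => segre_vertexIdeal_ne_top k a b ((Ideal.eq_top_iff_one _).mpr h1), ?_⟩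
  intro J x hJ hx hxJ
  obtain ⟨c, hc⟩ := segre_exists_sub_algebraMap_mem_vertexIdeal k a b x
  have hc0 : c ≠ 0 := by
    intro h0
    rw [h0, map_zero, sub_zero] at hc
    exact hx hc
  have hcJ : algebraMap k ↥SR[a, b] c ∈ J := by
    have := J.sub_mem hxJ (hJ hc)
    rwa [sub_sub_cancel] at this
  have hunit : IsUnit (algebraMap k ↥SR[a, b] c) := (IsUnit.mk0 c hc0).map _
  exact J.eq_top_of_isUnit_mem hcJ hunit ▸ Submodule.mem_top

/-- **VARIETIES WITH ÉTALE SEGRE-CONE SINGULARITIES ARE RESOLVABLE (every `a, b ≥ 2`, every field, arbitrary residue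
fields).** Let `X` be an integral `k`-scheme locally of finite type with finitely many singular points, each of which is
`φ y` for an ÉTALE morphism `φ : Spec k[xᵢyⱼ] → X` from a Segre cone and its vertex `y` (the point containing every
`xᵢyⱼ`). Then `X` has a resolution of singularities — e.g. every threefold over any field whose singularities are
finitely many points étale-locally of the form `xw = yz`. [cite: Kollar2007, §2.2] -/
theorem hasResolution_of_isolated_segre_etale_charts (X : Scheme.{0}) [IsIntegral X]
    (f : X ⟶ Spec (.of k)) [LocallyOfFiniteType f] (hfin : (Scheme.regularLocus X)ᶜ.Finite)
    (hchart : ∀ x : X, x ∉ Scheme.regularLocus X →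
      ∃ (a b : ℕ) (_ : 2 ≤ a) (_ : 2 ≤ b) (φ : Spec (CommRingCat.of ↥SR[a, b]) ⟶ X) (_ : Etale φ)
        (y : Spec (CommRingCat.of ↥SR[a, b])), φ y = x ∧ SM[a, b] ≤ y.asIdeal) :
    Scheme.HasResolution X := by
  refine EtaleChartAffineOpen.hasResolution_of_isolated_etale_pointBlowup_of_affineOpen k X f hfin
    fun x hx => ?_
  obtain ⟨a, b, ha, hb, φ, hφ, y, hyx, hSM⟩ := hchart x hx
  have hy : y.asIdeal = SM[a, b] :=
    ((segre_vertexIdeal_isMaximal k a b).eq_of_le y.isPrime.ne_top hSM).symm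
  have hregy : Scheme.IsRegular (affineBlowup y.asIdeal) := by
    rw [hy]; exact segreCone_isRegular_affineBlowup k a b
  exact ⟨Spec (CommRingCat.of ↥SR[a, b]), φ, hφ, y, hyx, ⊤, isAffineOpen_top _, trivial,
    isRegular_affineBlowup_primeIdealOf_top (↥SR[a, b]) y hregy⟩

end SegreEtaleCharts

end Segre

end Summit.ResolutionOfSingularities.ResolutionOfSingularities.Theorems.FRationalResolution

end
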